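import Mathlib.RepresentationTheory.Maschke
import Summits.HodgeConjecture.HodgeConjecture.Theorems.SoloBlindLocalTransport
import Literature.AlgebraicGeometry.HodgeTheory.ComplexConjugationHolds
import HarnessLib

/-!
# The reflection principle, non-degenerate form: `HC(X) ⟺` the residual Hodge classes are algebraic

Solo-blind residency on `HodgeConjecture`, session s7; claims SB-C39 – SB-C41 of its `CLAIMS.jsonl`,
companion prose `paper/wall.md` §7 (the theorem-schema of the wall).

The sibling file `SoloBlindReflectionPrinciple` (same namespace; not imported here, so that the two files are
independent — the Maschke step is re-run inline in `mem_of_res`) proved the *degenerate* form of the principle: given a finite group of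
linear symmetries `ρ` of `H²ᵖ(X(ℂ); ℂ)` preserving Hodge classes and algebraic classes and a set `R`
of elements whose norms `N_g = Σ_{i < ord g} ρ(gⁱ)` send Hodge classes to algebraic classes, the Hodge
conjecture for `X` holds as soon as the residual part `Res = ⋂_{g ∈ R} ker N_g` meets the span of the
Hodge classes trivially. This file removes the degeneracy hypothesis and records the principle as an
honest EQUIVALENCE, which is the shape in which the residency's wall is stated:

* `mem_of_res`, `mem_of_res'` (linear algebra, any field with `|G|` invertible): if every vector of
  `span H` (resp. of `span H ∩ W`) killed by all the norms `N_g`, `g ∈ R`, lies in `A`, then `H ⊆ A`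
  (resp. `H ∩ W ⊆ A`). Proof: Maschke gives a `G`-stable complement `q` of `A ∩ span H ∩ W` inside
  `span H ∩ W`; write `c = a + r` with `a ∈ A`, `r ∈ q`; each norm `N_g r` lies in `A ∩ q = 0`, so `r` is
  residual, hence `r ∈ A` by hypothesis. `subset_iff_res`: with such data,
  `H ⊆ A ⟺ span H ∩ Res ⊆ A` (the forward direction is linearity alone).
* `hodgeConjectureFor_of_res`, `hodgeConjectureFor_iff_res`: the instantiation `k = ℂ`,
  `V = H²ᵖ(X(ℂ); ℂ)`, `H` = rational `(p,p)`-classes, `A = algebraicClasses X p`. For FIXED reflection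
  data `(G_p, ρ_p, R_p)_p` satisfying the three transport hypotheses (Hodge classes to Hodge classes,
  algebraic to algebraic, norms of Hodge classes algebraic — for automorphisms `g` of a fourfold with
  `X/⟨g⟩` smooth uniruled this is Conte–Murre), **`HodgeConjectureFor n X` is equivalent to: every
  `ℂ`-combination of Hodge classes lying in `Res_p` is algebraic, for every `p`.**
* `hodgeConjecture_iff_exists_res`: the summit form. `HodgeConjecture ⟺` every smooth projective `X`
  carries, in every codimension, reflection data whose residual Hodge span is algebraic. (The forward
  direction is witnessed by the trivial data `G = 1`, `R = ∅`, for which `Res = H²ᵖ`: the criterion is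
  complete for the trivial reason and INFORMATIVE exactly to the extent that `Res` is small — this is
  the precise sense in which `Res` is the wall.)

## What this says about the wall (mathematics, not formalised)

For `g` an automorphism with smooth quotient `π : X → Y = X/⟨g⟩`, `Im N_g = π^* H^{2p}(Y)`. When `Y` is
a smooth uniruled fourfold, `CH₀(Y)_ℚ` is supported on a threefold and the Bloch–Srinivas decomposition
of the diagonal gives `H⁴(Y, ℚ) = N¹H⁴(Y, ℚ)` (coniveau one) — whence Conte–Murre — and `π^*`
preserves coniveau, so `Res^⊥ = Σ_{g ∈ R} Im N_g ⊂ N¹H⁴(X, ℚ)`: **the reflection principle never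
leaves coniveau one.** Conversely every Hodge class in `N^{p-1}H^{2p}(X, ℚ)` is algebraic (Deligne:
`N^{p-1}H^{2p} = Σ` Gysin images of `H²` of resolved subvarieties of codimension `p - 1`; polarised
Hodge structures are semisimple; Lefschetz `(1,1)`). So for a fourfold the residual statement
isolated by `hodgeConjectureFor_iff_res` splits as

  `Hdg ∩ Res ⊂ Alg ⟸ (Hdg ∩ Res ⊂ N¹H⁴)`, i.e. the generalized Hodge conjecture in coniveau 1 for
  the smallest FLAT sub-Hodge structure `B ⊂ Res` containing the class, **when `h^{4,0}(B) = 0`**;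

and has no such reduction when `h^{4,0}(B) ≠ 0`. On the residency's test families (sextic fourfolds
with a torus of symmetries) the first kind of instance is the rank-7 piece `B = W⁻` of Hodge type
`(2,3,2)` on the surface `F1|Σ` (sixteen special points found numerically in s5–s6): there the wall
is `GHC¹(B)`, a statement flat over the parameter surface. The second kind is the rank-5
hypergeometric piece `W₀` (Hodge type `(1,1,1,1,1)`) of the Dwork pencil: there nothing in print
reduces the statement. References: S. Bloch, V. Srinivas, Amer. J. Math. 105 (1983) 1235–1253,
Thm. 1; A. Conte, J. P. Murre, Math. Ann. 238 (1978) 79–88; P. Deligne, *The Hodge conjecture* (Clay,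
2000), §1 and remark (coniveau); C. Voisin, *The generalized Hodge and Bloch conjectures are equivalent
for general complete intersections*, Ann. Sci. ÉNS 46 (2013), arXiv:1107.2600; C. Voisin, *Hodge and
generalized Hodge conjectures, coniveau and algebraic cycles*, J. Open Math. Problems 1 (2025).
-/

noncomputable section

open CategoryTheory
open Literature.AlgebraicGeometry Literature.AlgebraicGeometry.Motives
open Literature.AlgebraicGeometry.HodgeTheory
open Literature.AlgebraicTopology.SingularHomology

namespace Summit.HodgeConjecture.HodgeConjecture.Theorems.SoloBlind

/-! ### §1. Linear algebra: residual vectors in `A` suffice -/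

section Abstract

variable {k G V : Type*} [Field k] [Group G] [AddCommGroup V] [Module k V]

/-- The span of a `G`-stable set is `G`-stable. -/
theorem span_stable (ρ : Representation k G V) (H : Set V) (hH : ∀ g, ∀ c ∈ H, ρ g c ∈ H) (g : G)
    {v : V} (hv : v ∈ Submodule.span k H) : ρ g v ∈ Submodule.span k H :=
  (Submodule.span_le.2 fun c hc => Submodule.subset_span (hH g c hc) :
    Submodule.span k H ≤ (Submodule.span k H).comap (ρ g)) hv

/-- If the norms `N_g`, `g ∈ R`, send `H` into a subspace `A`, they send `span H` into `A`. -/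
theorem norm_mem_of_span (ρ : Representation k G V) (H : Set V) (A : Submodule k V) (R : Set G)
    (hN : ∀ g ∈ R, ∀ c ∈ H, (∑ i ∈ Finset.range (orderOf g), ρ (g ^ i) c) ∈ A)
    {g : G} (hg : g ∈ R) {v : V} (hv : v ∈ Submodule.span k H) :
    (∑ i ∈ Finset.range (orderOf g), ρ (g ^ i) v) ∈ A := by
  let N : V →ₗ[k] V := ∑ i ∈ Finset.range (orderOf g), ρ (g ^ i)
  have hNapp : ∀ v, N v = ∑ i ∈ Finset.range (orderOf g), ρ (g ^ i) v := fun v => by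
    simp [N, LinearMap.sum_apply]
  have hle : Submodule.span k H ≤ A.comap N :=
    Submodule.span_le.2 fun c hc => by
      show N c ∈ A
      rw [hNapp]
      exact hN g hg c hc
  have := hle hv
  rw [Submodule.mem_comap, hNapp] at this
  exact this

/-- **Reflection criterion, non-degenerate form (protected blocks).** `ρ` a representation of a
finite group `G` on `V` (`|G|` invertible in `k`), `H ⊆ V` a `G`-stable set, `A ≤ V` and `W ≤ V`
`G`-stable subspaces, `R ⊆ G` such that the norm `N_g c`, `g ∈ R`, of every `c ∈ H` lies in `A`.
If every vector of `span H ∩ W` killed by all `N_g`, `g ∈ R`, lies in `A`, then `H ∩ W ⊆ A`. -/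
theorem mem_of_res [Finite G] [NeZero (Nat.card G : k)] (ρ : Representation k G V)
    (H : Set V) (A : Submodule k V) (hH : ∀ g, ∀ c ∈ H, ρ g c ∈ H)
    (hA : ∀ g, ∀ c ∈ A, ρ g c ∈ A) (R : Set G)
    (hN : ∀ g ∈ R, ∀ c ∈ H, (∑ i ∈ Finset.range (orderOf g), ρ (g ^ i) c) ∈ A)
    (W : Submodule k V) (hW : ∀ g, ∀ w ∈ W, ρ g w ∈ W)
    (hWres : ∀ w ∈ W, w ∈ Submodule.span k H →
      (∀ g ∈ R, (∑ i ∈ Finset.range (orderOf g), ρ (g ^ i) w) = 0) → w ∈ A)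
    {c : V} (hcW : c ∈ W) (hc : c ∈ H) : c ∈ A := by
  -- the subrepresentations `Hdg = span H ⊓ W` and `Alg = A ⊓ Hdg`
  let Hdg : Subrepresentation ρ :=
    { toSubmodule := Submodule.span k H ⊓ W
      apply_mem_toSubmodule := fun g v hv => ⟨span_stable ρ H hH g hv.1, hW g v hv.2⟩ }
  let Alg : Subrepresentation ρ :=
    { toSubmodule := A ⊓ (Submodule.span k H ⊓ W)
      apply_mem_toSubmodule := fun g v hv =>
        ⟨hA g v hv.1, span_stable ρ H hH g hv.2.1, hW g v hv.2.2⟩ }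
  -- subrepresentations are stable under every norm; the norms map `Hdg` into `Alg`
  have hnorm : ∀ (σ : Subrepresentation ρ) (g : G) (v : V), v ∈ σ →
      (∑ i ∈ Finset.range (orderOf g), ρ (g ^ i) v) ∈ σ := fun σ g v hv =>
    σ.toSubmodule.sum_mem fun i _ => σ.apply_mem_toSubmodule (g ^ i) hv
  have hN' : ∀ g ∈ R, ∀ v ∈ Hdg, (∑ i ∈ Finset.range (orderOf g), ρ (g ^ i) v) ∈ Alg :=
    fun g hg v hv => ⟨norm_mem_of_span ρ H A R hN hg hv.1, hnorm Hdg g v hv⟩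
  -- Maschke: a `G`-stable complement `q` of `Alg`; decompose `c = a + r`, `a ∈ Alg`, `r ∈ q`
  obtain ⟨q, hq⟩ := exists_isCompl Alg
  have hcH : c ∈ Hdg := ⟨Submodule.subset_span hc, hcW⟩
  have htop : c ∈ (Alg ⊔ q).toSubmodule := by
    rw [hq.sup_eq_top]
    exact Submodule.mem_top
  obtain ⟨a, ha, r, hr, hsum⟩ :=
    Submodule.mem_sup.1 (show c ∈ Alg.toSubmodule ⊔ q.toSubmodule from htop)
  -- `r = c - a ∈ Hdg`, and each norm `N_g r` lies in `Alg ⊓ q = ⊥`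
  have hrH : r ∈ Hdg := by
    have h := Hdg.toSubmodule.sub_mem (show c ∈ Hdg.toSubmodule from hcH)
      (show a ∈ Hdg.toSubmodule from ha.2)
    rwa [← hsum, add_sub_cancel_left] at h
  have hr0 : ∀ g ∈ R, (∑ i ∈ Finset.range (orderOf g), ρ (g ^ i) r) = 0 := by
    intro g hg
    have hmem : (∑ i ∈ Finset.range (orderOf g), ρ (g ^ i) r) ∈ (Alg ⊓ q).toSubmodule :=
      show _ ∈ Alg.toSubmodule ⊓ q.toSubmodule from ⟨hN' g hg r hrH, hnorm q g r hr⟩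
    rw [hq.inf_eq_bot] at hmem
    exact (Submodule.mem_bot k).1 hmem
  rw [← hsum]
  exact A.add_mem ha.1 (hWres r hrH.2 hrH.1 hr0)

/-- **Reflection criterion, non-degenerate form (global).** As `mem_of_res` with `W = V`: if every
vector of `span H` killed by all the norms `N_g`, `g ∈ R` — i.e. every vector of `span H ∩ Res` —
lies in `A`, then `H ⊆ A`. -/
theorem mem_of_res' [Finite G] [NeZero (Nat.card G : k)] (ρ : Representation k G V)
    (H : Set V) (A : Submodule k V) (hH : ∀ g, ∀ c ∈ H, ρ g c ∈ H)
    (hA : ∀ g, ∀ c ∈ A, ρ g c ∈ A) (R : Set G)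
    (hN : ∀ g ∈ R, ∀ c ∈ H, (∑ i ∈ Finset.range (orderOf g), ρ (g ^ i) c) ∈ A)
    (hRes : ∀ w ∈ Submodule.span k H,
      (∀ g ∈ R, (∑ i ∈ Finset.range (orderOf g), ρ (g ^ i) w) = 0) → w ∈ A)
    {c : V} (hc : c ∈ H) : c ∈ A :=
  mem_of_res ρ H A hH hA R hN ⊤ (fun _ _ _ => Submodule.mem_top) (fun w _ hw h0 => hRes w hw h0)
    Submodule.mem_top hc

/-- **The principle as an equivalence.** With reflection data as in `mem_of_res'`,
`H ⊆ A ⟺ span H ∩ Res ⊆ A` (`Res = ⋂_{g ∈ R} ker N_g`); the forward direction is linearity. -/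
theorem subset_iff_res [Finite G] [NeZero (Nat.card G : k)] (ρ : Representation k G V)
    (H : Set V) (A : Submodule k V) (hH : ∀ g, ∀ c ∈ H, ρ g c ∈ H)
    (hA : ∀ g, ∀ c ∈ A, ρ g c ∈ A) (R : Set G)
    (hN : ∀ g ∈ R, ∀ c ∈ H, (∑ i ∈ Finset.range (orderOf g), ρ (g ^ i) c) ∈ A) :
    H ⊆ A ↔ ∀ w ∈ Submodule.span k H,
      (∀ g ∈ R, (∑ i ∈ Finset.range (orderOf g), ρ (g ^ i) w) = 0) → w ∈ A :=
  ⟨fun h _ hw _ => (Submodule.span_le.2 h) hw, fun h _ hc => mem_of_res' ρ H A hH hA R hN h hc⟩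

end Abstract

/-! ### §2. `HodgeConjectureFor n X ⟺` the residual Hodge span is algebraic -/

section Hodge

variable {n : ℕ} {X : SchemeOver ℂ}

/-- **Non-degenerate reflection criterion for `HodgeConjectureFor`.** If `X` has a Hodge model and,
in every codimension `p`, `H²ᵖ(X(ℂ); ℂ)` carries a representation `ρ` of a finite group preserving
Hodge classes and algebraic classes, with a set `R` of elements whose norms send Hodge classes to
algebraic classes, and every `ℂ`-combination of Hodge classes killed by all these norms (i.e. lying in
`Res = ⋂_{g ∈ R} ker N_g`) is algebraic, then the Hodge conjecture holds for `X`.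
[cite: ConteMurre1978] [cite: BlochSrinivas1983] [cite: Deligne2000, §1] -/
theorem hodgeConjectureFor_of_res (A : HodgeModel n X)
    (h : ∀ p : ℕ, ∃ (G : Type) (_ : Group G) (_ : Finite G)
      (ρ : Representation ℂ G (complexBetti X (2 * p))) (R : Set G),
      (∀ g (c : complexBetti X (2 * p)), IsRationalClass c → IsOfHodgeType n X (2 * p) p p c →
        IsRationalClass (ρ g c) ∧ IsOfHodgeType n X (2 * p) p p (ρ g c)) ∧
      (∀ g, ∀ c ∈ algebraicClasses X p, ρ g c ∈ algebraicClasses X p) ∧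
      (∀ g ∈ R, ∀ c : complexBetti X (2 * p), IsRationalClass c → IsOfHodgeType n X (2 * p) p p c →
        (∑ i ∈ Finset.range (orderOf g), ρ (g ^ i) c) ∈ algebraicClasses X p) ∧
      (∀ w ∈ Submodule.span ℂ
          {c : complexBetti X (2 * p) | IsRationalClass c ∧ IsOfHodgeType n X (2 * p) p p c},
        (∀ g ∈ R, (∑ i ∈ Finset.range (orderOf g), ρ (g ^ i) w) = 0) →
          w ∈ algebraicClasses X p)) :
    HodgeConjectureFor n X := by
  refine ⟨⟨A⟩, fun p c hrat hpp => ?_⟩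
  obtain ⟨G, _, _, ρ, R, hHdg, hAlg, hN, hRes⟩ := h p
  haveI : NeZero (Nat.card G : ℂ) := ⟨Nat.cast_ne_zero.2 (Nat.card_pos (α := G)).ne'⟩
  exact mem_of_res' ρ
    {c : complexBetti X (2 * p) | IsRationalClass c ∧ IsOfHodgeType n X (2 * p) p p c}
    (algebraicClasses X p) (fun g c hc => hHdg g c hc.1 hc.2) hAlg R
    (fun g hg c hc => hN g hg c hc.1 hc.2) hRes ⟨hrat, hpp⟩

/-- **`HodgeConjectureFor` is equivalent to the algebraicity of the residual Hodge span.** Fix a Hodge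
model of `X` and, in every codimension `p`, reflection data: a representation `ρ p` of a finite group
`G p` on `H²ᵖ(X(ℂ); ℂ)` preserving Hodge classes and algebraic classes, and a set `R p` of elements
whose norms send Hodge classes to algebraic classes. Then the Hodge conjecture for `X` holds if and
only if, for every `p`, every `ℂ`-combination of Hodge classes killed by all the norms `N_g`,
`g ∈ R p`, is algebraic. (Forward: linearity. Backward: `hodgeConjectureFor_of_res`.) For the Dwork
pencil of sextic fourfolds with its `6⁴ ⋊ S₆`-reflections this reads: `HC(X_ψ) ⟺` the Hodge classes
in the rank-5 hypergeometric piece `W₀(ψ)` are algebraic. [cite: ConteMurre1978]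
[cite: Deligne2000, §1] -/
theorem hodgeConjectureFor_iff_res (A : HodgeModel n X) (G : ℕ → Type) [∀ p, Group (G p)]
    [∀ p, Finite (G p)] (ρ : ∀ p, Representation ℂ (G p) (complexBetti X (2 * p)))
    (R : ∀ p, Set (G p))
    (hHdg : ∀ p g (c : complexBetti X (2 * p)), IsRationalClass c →
      IsOfHodgeType n X (2 * p) p p c →
        IsRationalClass (ρ p g c) ∧ IsOfHodgeType n X (2 * p) p p (ρ p g c))
    (hAlg : ∀ p g, ∀ c ∈ algebraicClasses X p, ρ p g c ∈ algebraicClasses X p)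
    (hN : ∀ p, ∀ g ∈ R p, ∀ c : complexBetti X (2 * p), IsRationalClass c →
      IsOfHodgeType n X (2 * p) p p c →
        (∑ i ∈ Finset.range (orderOf g), ρ p (g ^ i) c) ∈ algebraicClasses X p) :
    HodgeConjectureFor n X ↔
      ∀ p, ∀ w ∈ Submodule.span ℂ
          {c : complexBetti X (2 * p) | IsRationalClass c ∧ IsOfHodgeType n X (2 * p) p p c},
        (∀ g ∈ R p, (∑ i ∈ Finset.range (orderOf g), ρ p (g ^ i) w) = 0) →
          w ∈ algebraicClasses X p := by
  constructor
  · intro hX p w hw _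
    exact (Submodule.span_le.2 fun c hc => hX.2 p c hc.1 hc.2) hw
  · intro h
    exact hodgeConjectureFor_of_res A fun p =>
      ⟨G p, inferInstance, inferInstance, ρ p, R p, hHdg p, hAlg p, hN p, h p⟩

end Hodge

/-! ### §3. The summit form -/

section Summit

/-- **Non-degenerate reflection criterion for the summit.** [cite: ConteMurre1978]
[cite: Deligne2000, §1] -/
theorem hodgeConjecture_of_forall_res
    (h : ∀ ⦃n : ℕ⦄ ⦃X : SchemeOver ℂ⦄, IsSmoothProjective n X → ∀ p : ℕ,
      ∃ (G : Type) (_ : Group G) (_ : Finite G)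
        (ρ : Representation ℂ G (complexBetti X (2 * p))) (R : Set G),
        (∀ g (c : complexBetti X (2 * p)), IsRationalClass c → IsOfHodgeType n X (2 * p) p p c →
          IsRationalClass (ρ g c) ∧ IsOfHodgeType n X (2 * p) p p (ρ g c)) ∧
        (∀ g, ∀ c ∈ algebraicClasses X p, ρ g c ∈ algebraicClasses X p) ∧
        (∀ g ∈ R, ∀ c : complexBetti X (2 * p), IsRationalClass c →
          IsOfHodgeType n X (2 * p) p p c →
          (∑ i ∈ Finset.range (orderOf g), ρ (g ^ i) c) ∈ algebraicClasses X p) ∧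
        (∀ w ∈ Submodule.span ℂ
            {c : complexBetti X (2 * p) | IsRationalClass c ∧ IsOfHodgeType n X (2 * p) p p c},
          (∀ g ∈ R, (∑ i ∈ Finset.range (orderOf g), ρ (g ^ i) w) = 0) →
            w ∈ algebraicClasses X p)) :
    _root_.HodgeConjecture := by
  intro n X hX
  obtain ⟨A⟩ := (nonempty_hodgeModel_holds : nonempty_hodgeModel n X) hX
  exact hodgeConjectureFor_of_res A (h hX)

/-- **The summit is equivalent to the existence of reflection data with algebraic residual Hodge
span on every smooth projective variety.** The forward direction is witnessed by the trivial data
(`G = 1`, `R = ∅`, `Res = H²ᵖ`): the criterion is complete for a trivial reason and informative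
exactly to the extent that `Res` can be made small — the residency's wall. [cite: ConteMurre1978]
[cite: Deligne2000, §1] -/
theorem hodgeConjecture_iff_exists_res :
    _root_.HodgeConjecture ↔
      ∀ ⦃n : ℕ⦄ ⦃X : SchemeOver ℂ⦄, IsSmoothProjective n X → ∀ p : ℕ,
        ∃ (G : Type) (_ : Group G) (_ : Finite G)
          (ρ : Representation ℂ G (complexBetti X (2 * p))) (R : Set G),
          (∀ g (c : complexBetti X (2 * p)), IsRationalClass c →
            IsOfHodgeType n X (2 * p) p p c →
            IsRationalClass (ρ g c) ∧ IsOfHodgeType n X (2 * p) p p (ρ g c)) ∧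
          (∀ g, ∀ c ∈ algebraicClasses X p, ρ g c ∈ algebraicClasses X p) ∧
          (∀ g ∈ R, ∀ c : complexBetti X (2 * p), IsRationalClass c →
            IsOfHodgeType n X (2 * p) p p c →
            (∑ i ∈ Finset.range (orderOf g), ρ (g ^ i) c) ∈ algebraicClasses X p) ∧
          (∀ w ∈ Submodule.span ℂ
              {c : complexBetti X (2 * p) | IsRationalClass c ∧ IsOfHodgeType n X (2 * p) p p c},
            (∀ g ∈ R, (∑ i ∈ Finset.range (orderOf g), ρ (g ^ i) w) = 0) →
              w ∈ algebraicClasses X p) := by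
  refine ⟨fun hHC n X hX p => ?_, hodgeConjecture_of_forall_res⟩
  refine ⟨PUnit, inferInstance, inferInstance, 1, ∅, ?_, ?_, ?_, ?_⟩
  · intro g c hrat hpp
    simpa using And.intro hrat hpp
  · intro g c hc
    simpa using hc
  · intro g hg
    exact absurd hg (by simp)
  · intro w hw _
    exact (Submodule.span_le.2 fun c hc => (hHC hX).2 p c hc.1 hc.2) hw

end Summit

end Summit.HodgeConjecture.HodgeConjecture.Theorems.SoloBlind

end
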